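/-
Copyright (c) 2026. All rights reserved.
Released under Apache 2.0 license as described in the file LICENSE.
Authors: abc-iut cell, prover seat abc-iut-E-t32 (gen 11).
-/
import Literature.IUT.LogVolume.WildQuadraticDyadicDifferent
import Literature.IUT.LogVolume.DifferentDivisorDegree
import Literature.IUT.LogVolume.LocalDegreeBridge
import Literature.IUT.LogVolume.RescaledCompletionInvariants
import Literature.IUT.LogVolume.TensorPacketUnramified
import HarnessLib

/-!
# The discriminant of a number field all of whose completions are on the «fixed-ball» list: `|d_F| ≤ 12^{⌊n/2⌋}`

Classical global number theory (Serre, *Local Fields* III §4 Prop. 10, §6 Prop. 13; Neukirch ANT III (2.9), (2.11)):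
for a number field `F` of degree `n` whose finite places `v` all have one of the local shapes

* over `2`: unramified (`e = 1`), or `(e, f) = (2, 1)` with `log₂(𝒪_v^×) = 2𝒪_v` (the `ℚ₂(√3)`-shape);
* over `3`: `e = 1`, or `(e, f) = (2, 1)` (tame);
* over `p ≥ 5`: unramified,

the absolute different is `𝔇_{F/ℚ} = ∏_{v ∈ A} v² · ∏_{v ∈ B} v` (`A` = ramified places over `2`, `B` = ramified places
over `3`), so that

* `log_natAbs_discr_eq` / `natAbs_discr_eq` — `|d_F| = N(𝔇) = 4^{#A}·3^{#B}` (abc-iut-S1's `degF_differentDivisor`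
  `= log N(𝔇)`, the place-by-place formula `degF_differentDivisor_eq_sum_local_of_subset` with the local differents
  `d_v = 0` (unramified, `differentOrd_eq_zero_of_absRamificationIdx_eq_one`), `d_v = 1/2` (tame quadratic,
  `differentOrd_eq_of_not_dvd`), `d_v = 1` (the `ℚ₂(√3)`-shape, `differentOrd_eq_one_of_logUnits_eq_closedBall_norm_two`);
* `two_mul_card_ramifiedTwo_le` / `two_mul_card_ramifiedThree_le` — `2·#A ≤ n`, `2·#B ≤ n` (each such place has local degree `2`;
  `sum_localDeg`);
* **`natAbs_discr_le_twelve_pow`** — hence `|d_F| ≤ 12^{⌊n/2⌋}`.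

These shapes are exactly the abc-iut cell's «fixed-ball list» (`Joshi/TestGenuinePinsDividingLine`,
`localShape_of_pinnedRegions_settingPrVolSharp`); this file is its pins-free discriminant consequence (R-J row R-23b).
Nothing here bears on the disputed [IUTchIII] Cor. 3.12.
-/

noncomputable section

open Metric Set
open scoped NumberField Classical

namespace Literature.IUT.LogVolume

namespace FixedBallShapes

open NumberField IsDedekindDomain Literature.NumberTheory.NumberFields

variable (F : Type) [Field F] [NumberField F]

variable {F}

/-! ## 1. Local terms -/

/-- `v ∈ V(F)_p ⇒ p ∈ v`. [cite: NeukirchANT1999, Ch. I (8.3)] -/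
theorem natCast_mem_of_mem_placesOver {p : ℕ} [Fact p.Prime] {v : HeightOneSpectrum (𝓞 F)}
    (hv : v ∈ placesOver F p) : ((p : ℕ) : 𝓞 F) ∈ v.asIdeal := by
  have h := (mem_placesOver_iff_residueChar v).mp hv
  rw [← h]
  exact natCast_residueChar_mem F v

/-- An unramified place contributes nothing to the different: `e_v = 1 ⇒ ord_v(𝔇) = 0`.
[cite: SerreLocalFields1979, Ch. III §6 Prop. 13] -/
theorem multiplicity_eq_zero_of_ramificationIdx_eq_one {p : ℕ} [Fact p.Prime] (v : HeightOneSpectrum (𝓞 F))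
    (hv : ((p : ℕ) : 𝓞 F) ∈ v.asIdeal) (he : v.asIdeal.ramificationIdx ℤ = 1) :
    multiplicity v.asIdeal (differentIdeal ℤ (𝓞 F)) = 0 := by
  have hd := differentOrd_rescaledCompletion F p v hv
  rw [differentOrd_eq_zero_of_absRamificationIdx_eq_one p (RescaledCompletion F p v hv)
    (by rw [absRamificationIdx_rescaledCompletion F p v hv, he]), he] at hd
  simpa using hd.symm

/-- A place of the `ℚ₂(√3)`-shape contributes `2·log 2 = log 4`: `ord_v(𝔇)·log N(v) = n_v·d_v·log 2` with
`n_v = 2`, `d_v = 1`. [cite: SerreLocalFields1979, Ch. III §6 Prop. 13] -/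
theorem localTerm_two {v : HeightOneSpectrum (𝓞 F)} (hv : ((2 : ℕ) : 𝓞 F) ∈ v.asIdeal)
    (he : v.asIdeal.ramificationIdx ℤ = 2) (hf : v.asIdeal.inertiaDeg ℤ = 1)
    (hlog : logUnits (RescaledCompletion F 2 v hv) =
      closedBall (0 : RescaledCompletion F 2 v hv) ‖(2 : RescaledCompletion F 2 v hv)‖) :
    (multiplicity v.asIdeal (differentIdeal ℤ (𝓞 F)) : ℝ) * logNorm F v = Real.log 4 := by
  have heK : absRamificationIdx 2 (RescaledCompletion F 2 v hv) = 2 := by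
    rw [absRamificationIdx_rescaledCompletion F 2 v hv, he]
  have hfK : residueDegree 2 (RescaledCompletion F 2 v hv) = 1 := by
    rw [residueDegree_rescaledCompletion F 2 v hv, hf]
  rw [multiplicity_mul_logNorm_eq F 2 v hv,
    WildQuadraticDyadic.differentOrd_eq_one_of_logUnits_eq_closedBall_norm_two heK hfK hlog, localDeg, he, hf,
    show (4 : ℝ) = 2 ^ 2 by norm_num, Real.log_pow]
  push_cast
  ring

/-- A tame quadratic place over `3` contributes `log 3`: `n_v = 2`, `d_v = 1/2`. [cite: SerreLocalFields1979, Ch. III §6 Prop. 13] -/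
theorem localTerm_three {v : HeightOneSpectrum (𝓞 F)} (hv : ((3 : ℕ) : 𝓞 F) ∈ v.asIdeal)
    (he : v.asIdeal.ramificationIdx ℤ = 2) (hf : v.asIdeal.inertiaDeg ℤ = 1) :
    (multiplicity v.asIdeal (differentIdeal ℤ (𝓞 F)) : ℝ) * logNorm F v = Real.log 3 := by
  haveI : Fact (Nat.Prime 3) := ⟨Nat.prime_three⟩
  have heK : absRamificationIdx 3 (RescaledCompletion F 3 v hv) = 2 := by
    rw [absRamificationIdx_rescaledCompletion F 3 v hv, he]
  have hd : differentOrd 3 (RescaledCompletion F 3 v hv) = 2⁻¹ := by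
    rw [differentOrd_eq_of_not_dvd 3 (RescaledCompletion F 3 v hv) (by rw [heK]; decide), heK]
    norm_num
  rw [multiplicity_mul_logNorm_eq F 3 v hv, hd, localDeg, he, hf]
  push_cast
  ring

/-! ## 2. The global formula `|d_F| = 4^{#A}·3^{#B}` -/

section Global

variable (F)
variable
  (h2 : ∀ (v : HeightOneSpectrum (𝓞 F)) (hv : ((2 : ℕ) : 𝓞 F) ∈ v.asIdeal),
    v.asIdeal.ramificationIdx ℤ = 1 ∨
      (v.asIdeal.ramificationIdx ℤ = 2 ∧ v.asIdeal.inertiaDeg ℤ = 1 ∧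
        logUnits (RescaledCompletion F 2 v hv) =
          closedBall (0 : RescaledCompletion F 2 v hv) ‖(2 : RescaledCompletion F 2 v hv)‖))
  (h3 : ∀ (v : HeightOneSpectrum (𝓞 F)), ((3 : ℕ) : 𝓞 F) ∈ v.asIdeal →
    v.asIdeal.ramificationIdx ℤ = 1 ∨ (v.asIdeal.ramificationIdx ℤ = 2 ∧ v.asIdeal.inertiaDeg ℤ = 1))
  (h5 : ∀ (v : HeightOneSpectrum (𝓞 F)), residueChar F v ≠ 2 → residueChar F v ≠ 3 →
    v.asIdeal.ramificationIdx ℤ = 1)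

/-- `V(F)_2` and `V(F)_3` are disjoint. [cite: NeukirchANT1999, Ch. I (8.3)] -/
theorem disjoint_placesOver_two_three : Disjoint (placesOver F 2) (placesOver F 3) := by
  haveI : Fact (Nat.Prime 3) := ⟨Nat.prime_three⟩
  rw [Finset.disjoint_left]
  intro v h2v h3v
  have h2' := (mem_placesOver_iff_residueChar v).mp h2v
  have h3' := (mem_placesOver_iff_residueChar v).mp h3v
  omega

include h5 in
/-- Off `V(F)_2 ∪ V(F)_3` the different has no support. [cite: SerreLocalFields1979, Ch. III §6 Prop. 13] -/
theorem multiplicity_eq_zero_of_not_mem {v : HeightOneSpectrum (𝓞 F)} (hv : v ∉ placesOver F 2 ∪ placesOver F 3) :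
    multiplicity v.asIdeal (differentIdeal ℤ (𝓞 F)) = 0 := by
  haveI : Fact (Nat.Prime 3) := ⟨Nat.prime_three⟩
  haveI : Fact (residueChar F v).Prime := ⟨residueChar_prime F v⟩
  rw [Finset.mem_union, not_or, mem_placesOver_iff_residueChar, mem_placesOver_iff_residueChar] at hv
  exact multiplicity_eq_zero_of_ramificationIdx_eq_one v (natCast_residueChar_mem F v) (h5 v hv.1 hv.2)

include h2 in
/-- The sum of the local terms over `V(F)_2` is `#A·log 4`. [cite: SerreLocalFields1979, Ch. III §6 Prop. 13] -/
theorem sum_placesOver_two :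
    ∑ v ∈ placesOver F 2, (multiplicity v.asIdeal (differentIdeal ℤ (𝓞 F)) : ℝ) * logNorm F v =
      ((placesOver F 2).filter fun v => v.asIdeal.ramificationIdx ℤ = 2).card * Real.log 4 := by
  have hsum : ∑ v ∈ placesOver F 2, (multiplicity v.asIdeal (differentIdeal ℤ (𝓞 F)) : ℝ) * logNorm F v =
      ∑ v ∈ placesOver F 2, (if v.asIdeal.ramificationIdx ℤ = 2 then Real.log 4 else 0) := by
    refine Finset.sum_congr rfl fun v hv => ?_
    have hv2 := natCast_mem_of_mem_placesOver hv
    rcases h2 v hv2 with he | ⟨he, hf, hlog⟩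
    · rw [if_neg (by rw [he]; decide), multiplicity_eq_zero_of_ramificationIdx_eq_one v hv2 he, Nat.cast_zero, zero_mul]
    · rw [if_pos he, localTerm_two hv2 he hf hlog]
  rw [hsum, Finset.sum_ite, Finset.sum_const_zero, add_zero, Finset.sum_const, nsmul_eq_mul]

include h3 in
/-- The sum of the local terms over `V(F)_3` is `#B·log 3`. [cite: SerreLocalFields1979, Ch. III §6 Prop. 13] -/
theorem sum_placesOver_three :
    ∑ v ∈ placesOver F 3, (multiplicity v.asIdeal (differentIdeal ℤ (𝓞 F)) : ℝ) * logNorm F v =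
      ((placesOver F 3).filter fun v => v.asIdeal.ramificationIdx ℤ = 2).card * Real.log 3 := by
  haveI : Fact (Nat.Prime 3) := ⟨Nat.prime_three⟩
  have hsum : ∑ v ∈ placesOver F 3, (multiplicity v.asIdeal (differentIdeal ℤ (𝓞 F)) : ℝ) * logNorm F v =
      ∑ v ∈ placesOver F 3, (if v.asIdeal.ramificationIdx ℤ = 2 then Real.log 3 else 0) := by
    refine Finset.sum_congr rfl fun v hv => ?_
    have hv3 := natCast_mem_of_mem_placesOver hv
    rcases h3 v hv3 with he | ⟨he, hf⟩
    · rw [if_neg (by rw [he]; decide), multiplicity_eq_zero_of_ramificationIdx_eq_one v hv3 he, Nat.cast_zero, zero_mul]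
    · rw [if_pos he, localTerm_three hv3 he hf]
  rw [hsum, Finset.sum_ite, Finset.sum_const_zero, add_zero, Finset.sum_const, nsmul_eq_mul]

include h2 h3 h5 in
/-- **`log |d_F| = #A·log 4 + #B·log 3`**: the absolute different is `∏_{v ∈ A} v² · ∏_{v ∈ B} v`.
[cite: SerreLocalFields1979, Ch. III §4 Prop. 10] [cite: NeukirchANT1999, Ch. III (2.9)] -/
theorem log_natAbs_discr_eq :
    Real.log ((NumberField.discr F).natAbs : ℝ) =
      ((placesOver F 2).filter fun v => v.asIdeal.ramificationIdx ℤ = 2).card * Real.log 4 +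
        ((placesOver F 3).filter fun v => v.asIdeal.ramificationIdx ℤ = 2).card * Real.log 3 := by
  haveI : Fact (Nat.Prime 3) := ⟨Nat.prime_three⟩
  have hT : ∀ v : HeightOneSpectrum (𝓞 F), multiplicity v.asIdeal (differentIdeal ℤ (𝓞 F)) ≠ 0 →
      v ∈ placesOver F 2 ∪ placesOver F 3 := by
    intro v hv
    by_contra hmem
    exact hv (multiplicity_eq_zero_of_not_mem F h5 hmem)
  rw [← degF_differentDivisor F, degF_differentDivisor_eq_sum_local_of_subset F _ hT]
  have hcongr : ∀ v ∈ placesOver F 2 ∪ placesOver F 3,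
      (haveI : Fact (residueChar F v).Prime := ⟨residueChar_prime F v⟩
       (localDeg F v : ℝ) *
          differentOrd (residueChar F v) (RescaledCompletion F (residueChar F v) v (natCast_residueChar_mem F v)) *
        Real.log (residueChar F v)) =
      (multiplicity v.asIdeal (differentIdeal ℤ (𝓞 F)) : ℝ) * logNorm F v := by
    intro v _
    haveI : Fact (residueChar F v).Prime := ⟨residueChar_prime F v⟩
    exact (multiplicity_mul_logNorm_eq F (residueChar F v) v (natCast_residueChar_mem F v)).symm
  rw [Finset.sum_congr rfl hcongr, Finset.sum_union (disjoint_placesOver_two_three F), sum_placesOver_two F h2,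
    sum_placesOver_three F h3]

include h2 h3 h5 in
/-- **`|d_F| = 4^{#A}·3^{#B}`.** [cite: NeukirchANT1999, Ch. III (2.9), (2.11)] -/
theorem natAbs_discr_eq :
    (NumberField.discr F).natAbs =
      4 ^ ((placesOver F 2).filter fun v => v.asIdeal.ramificationIdx ℤ = 2).card *
        3 ^ ((placesOver F 3).filter fun v => v.asIdeal.ramificationIdx ℤ = 2).card := by
  have hlog := log_natAbs_discr_eq F h2 h3 h5
  have hpos : (0 : ℝ) < ((NumberField.discr F).natAbs : ℝ) := by
    exact_mod_cast Int.natAbs_pos.mpr (NumberField.discr_ne_zero F)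
  have hpos' : (0 : ℝ) <
      ((4 ^ ((placesOver F 2).filter fun v => v.asIdeal.ramificationIdx ℤ = 2).card *
        3 ^ ((placesOver F 3).filter fun v => v.asIdeal.ramificationIdx ℤ = 2).card : ℕ) : ℝ) := by positivity
  have hlog' : Real.log ((NumberField.discr F).natAbs : ℝ) =
      Real.log ((4 ^ ((placesOver F 2).filter fun v => v.asIdeal.ramificationIdx ℤ = 2).card *
        3 ^ ((placesOver F 3).filter fun v => v.asIdeal.ramificationIdx ℤ = 2).card : ℕ) : ℝ) := by
    rw [hlog]; push_cast
    rw [Real.log_mul (by positivity) (by positivity), Real.log_pow, Real.log_pow]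
  exact_mod_cast Real.log_injOn_pos hpos hpos' hlog'

include h2 in
/-- Each ramified place over `2` has local degree `2`, so `2·#A ≤ [F:ℚ]`. [cite: NeukirchANT1999, Ch. II Prop. (6.8)] -/
theorem two_mul_card_ramifiedTwo_le :
    2 * ((placesOver F 2).filter fun v => v.asIdeal.ramificationIdx ℤ = 2).card ≤ Module.finrank ℚ F := by
  calc 2 * ((placesOver F 2).filter fun v => v.asIdeal.ramificationIdx ℤ = 2).card
        = ∑ v ∈ (placesOver F 2).filter (fun v => v.asIdeal.ramificationIdx ℤ = 2), 2 := by
          rw [Finset.sum_const, smul_eq_mul, mul_comm]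
    _ = ∑ v ∈ (placesOver F 2).filter (fun v => v.asIdeal.ramificationIdx ℤ = 2), localDeg F v := by
        refine Finset.sum_congr rfl fun v hv => ?_
        rw [Finset.mem_filter] at hv
        have hv2 := natCast_mem_of_mem_placesOver hv.1
        rcases h2 v hv2 with he | ⟨he, hf, -⟩
        · exact absurd (hv.2.symm.trans he) (by decide)
        · rw [localDeg, he, hf]
    _ ≤ ∑ v ∈ placesOver F 2, localDeg F v := Finset.sum_le_sum_of_subset (Finset.filter_subset _ _)
    _ = Module.finrank ℚ F := sum_localDeg F 2

include h3 in
/-- Each ramified place over `3` has local degree `2`, so `2·#B ≤ [F:ℚ]`. [cite: NeukirchANT1999, Ch. II Prop. (6.8)] -/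
theorem two_mul_card_ramifiedThree_le :
    2 * ((placesOver F 3).filter fun v => v.asIdeal.ramificationIdx ℤ = 2).card ≤ Module.finrank ℚ F := by
  haveI : Fact (Nat.Prime 3) := ⟨Nat.prime_three⟩
  calc 2 * ((placesOver F 3).filter fun v => v.asIdeal.ramificationIdx ℤ = 2).card
        = ∑ v ∈ (placesOver F 3).filter (fun v => v.asIdeal.ramificationIdx ℤ = 2), 2 := by
          rw [Finset.sum_const, smul_eq_mul, mul_comm]
    _ = ∑ v ∈ (placesOver F 3).filter (fun v => v.asIdeal.ramificationIdx ℤ = 2), localDeg F v := by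
        refine Finset.sum_congr rfl fun v hv => ?_
        rw [Finset.mem_filter] at hv
        have hv3 := natCast_mem_of_mem_placesOver hv.1
        rcases h3 v hv3 with he | ⟨he, hf⟩
        · exact absurd (hv.2.symm.trans he) (by decide)
        · rw [localDeg, he, hf]
    _ ≤ ∑ v ∈ placesOver F 3, localDeg F v := Finset.sum_le_sum_of_subset (Finset.filter_subset _ _)
    _ = Module.finrank ℚ F := sum_localDeg F 3

include h2 h3 h5 in
/-- **`|d_F| ≤ 12^{⌊[F:ℚ]/2⌋}`** for a number field all of whose completions are on the fixed-ball list.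
[cite: NeukirchANT1999, Ch. III (2.9), (2.11)] [cite: SerreLocalFields1979, Ch. III §6 Prop. 13] -/
theorem natAbs_discr_le_twelve_pow : (NumberField.discr F).natAbs ≤ 12 ^ (Module.finrank ℚ F / 2) := by
  rw [natAbs_discr_eq F h2 h3 h5]
  have hA : ((placesOver F 2).filter fun v => v.asIdeal.ramificationIdx ℤ = 2).card ≤ Module.finrank ℚ F / 2 :=
    (Nat.le_div_iff_mul_le two_pos).mpr (by rw [mul_comm]; exact two_mul_card_ramifiedTwo_le F h2)
  have hB : ((placesOver F 3).filter fun v => v.asIdeal.ramificationIdx ℤ = 2).card ≤ Module.finrank ℚ F / 2 :=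
    (Nat.le_div_iff_mul_le two_pos).mpr (by rw [mul_comm]; exact two_mul_card_ramifiedThree_le F h3)
  calc 4 ^ ((placesOver F 2).filter fun v => v.asIdeal.ramificationIdx ℤ = 2).card * 3 ^ ((placesOver F 3).filter fun v => v.asIdeal.ramificationIdx ℤ = 2).card
      ≤ 4 ^ (Module.finrank ℚ F / 2) * 3 ^ (Module.finrank ℚ F / 2) :=
        Nat.mul_le_mul (Nat.pow_le_pow_right (by norm_num) hA) (Nat.pow_le_pow_right (by norm_num) hB)
    _ = 12 ^ (Module.finrank ℚ F / 2) := by rw [← mul_pow]; norm_num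

include h2 h3 h5 in
/-- The same as an integer inequality `|d_F| ≤ 12^{⌊n/2⌋}`. [cite: NeukirchANT1999, Ch. III (2.9), (2.11)] -/
theorem abs_discr_le_twelve_pow : |NumberField.discr F| ≤ 12 ^ (Module.finrank ℚ F / 2) := by
  have h := natAbs_discr_le_twelve_pow F h2 h3 h5
  rw [Int.abs_eq_natAbs]
  exact_mod_cast h

end Global

end FixedBallShapes

end Literature.IUT.LogVolume

end
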